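import Mathlib
import Literature.Combinatorics.Additive.SquareDifferenceFreeSets
import Summits.MatrixMultiplication.MatrixMultiplication.Theorems.LevelGradedCohnUmansLevelOneGL2DesignsParabolaLift
import Summits.MatrixMultiplication.MatrixMultiplication.Theorems.LevelGradedCohnUmansLevelOneGL2DesignsTangencyUpperBound

/-!
# Parabola lifts for `stub_tangencySets` (crux `LevelOneGL2Designs`, stmt-MatrixMultiplication-14080):
the integer-lift count and the ceiling `p^{3/2} + 2p` of the axis

Companion of `LevelGradedCohnUmansLevelOneGL2DesignsParabolaLift.lean` (wall-breaker seat k2/12,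
axis "parabola lifts over finite fields").  Count: feeding Ruzsa's square-difference-free sets
(`Literature.Combinatorics.Additive.exists_sqDiffFree_ruzsa`, `…exists_sqDiffFree_card_ge`, base
`65`) into the loss-free integer parabola lift `tangencySet_intLift` gives

* `tangencySet_ruzsa` — strong representative systems of `AG(2,p)` (in the stub's dot-product
  format) of size exactly `M·455^t` whenever `M² + 4225^t ≤ p`;
  (the integer lift; superseded as a LOWER BOUND by the number-ring lifts `gaussLift` /
  `QuadraticLift.exists_srs_card_ge_rpow_five_fourths`, exponent `5/4` for every prime, but kept as
  the exact-count form of the HPVZ 2026 construction with Ruzsa's base `65`).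

Upper end:

* `parabolaFree_card_le` — every parabola-free `T ⊆ 𝔽_p²` (the residual object of the axis, see
  `tangencySets_of_parabolaFree`) has `|T| ≤ p^{3/2} + 2p`: lift, then the Illés–Szőnyi–Wettl
  count `srs_card_le_rpow` of `…TangencyUpperBound.lean`.  So the residual asks for parabola-free
  sets within a constant of their ceiling, with no spectral input; it is open and conjectured
  impossible (HPVZ Conjecture 10.2); see AXIS.md of the seat;
* `parabolaFree_univ_product`, `coclique_card_le_of_parabolaFree_bound`,
  `coclique_card_le_sqrt_add_two` — pencils `𝔽_p × K` over Paley cocliques are parabola-free, so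
  any bound for parabola-free sets is `p` times a bound for Paley cocliques: the NEGATION of the
  residual (`o(p^{3/2})`) would break the square-root barrier `α(Paley_p) = o(√p)` — out of
  reach as well.
-/

-- justification: the summit/problem path `MatrixMultiplication.MatrixMultiplication` is fixed by the
-- tree layout (D-0017), so the namespace necessarily repeats a component.
set_option linter.dupNamespace false

noncomputable section

open Matrix

namespace Summit.MatrixMultiplication.MatrixMultiplication.Theorems.LevelOneGL2Designs.ParabolaLift

section Ruzsa

variable {p : ℕ} [Fact p.Prime]

open Literature.Combinatorics.Additive in
/-- **Strong representative systems of size `M·455^t` in `AG(2,p)` whenever `M² + 65^{2t} ≤ p`**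
(integer parabola lift of Ruzsa's square-difference-free set, shifted into `[M², M² + 65^{2t})`;
Hunter–Pohoata–Verstraëte–Zhang 2026, proof of Theorem 1.2), in the format of
`stub_tangencySets`.  Taking `M ≈ √(p/2)` and `65^{2t} ≈ p/2` gives size
`≫ p^{1/2 + log 455 / log 4225} = p^{1.2331…}` for every prime `p`. [elementary] -/
theorem tangencySet_ruzsa (M t : ℕ) (h : M ^ 2 + 4225 ^ t ≤ p) :
    ∃ S : Finset ((Fin 2 → ZMod p) × (Fin 2 → ZMod p)), S.card = M * 455 ^ t ∧
      ∀ f ∈ S, ∀ f' ∈ S, (dotProduct f.1 f'.2 = 1 ↔ f = f') := by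
  classical
  obtain ⟨K, hcard, hlt, hK⟩ := exists_sqDiffFree_ruzsa t
  obtain ⟨S, hS, hprop⟩ := tangencySet_intLift (p := p) M (4225 ^ t) (K.image (· + M ^ 2))
    (by simp) (fun k hk => by
      simp only [Finset.mem_image] at hk
      obtain ⟨k, hk, rfl⟩ := hk
      have := hlt k hk
      omega)
    (fun k hk k' hk' j hj => by
      simp only [Finset.mem_image] at hk hk'
      obtain ⟨k, hk, rfl⟩ := hk
      obtain ⟨k', hk', rfl⟩ := hk'
      exact hK k hk k' hk' j (by omega)) h
  refine ⟨S, ?_, hprop⟩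
  rw [hS, Finset.card_image_of_injective _ (add_left_injective (M ^ 2)), hcard]

end Ruzsa

section Ceiling

variable {p : ℕ} [Fact p.Prime]

open Summit.MatrixMultiplication.MatrixMultiplication.Theorems.LevelOneGL2Designs.TangencyRandAlg in
/-- **Ceiling for parabola-free sets.**  If `T ⊆ 𝔽_p × 𝔽_p` is parabola-free then
`|T| ≤ p^{3/2} + 2p`: drop the `≤ p` parameters with `k = a²`, lift the rest to a strong
representative system of the same size (`tangency_of_parabolaFree`) and apply the
Illés–Szőnyi–Wettl count `srs_card_le_rpow` (`|S| ≤ p^{3/2} + p`).  So the axis' residual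
(parabola-free sets of size `c·p^{3/2}`) sits within a constant of its ceiling. [elementary] -/
theorem parabolaFree_card_le (T : Finset (ZMod p × ZMod p))
    (hT : ∀ t ∈ T, ∀ t' ∈ T, (t'.1 - t.1) ^ 2 = t.2 - t'.2 → t'.1 = t.1) :
    (T.card : ℝ) ≤ (p : ℝ) ^ (3 / 2 : ℝ) + 2 * p := by
  classical
  set T' := T.filter fun t => t.2 ≠ t.1 ^ 2 with hT'
  obtain ⟨S, hScard, hS⟩ := tangency_of_parabolaFree T'
    (fun t ht t' ht' => hT t (Finset.mem_filter.mp ht).1 t' (Finset.mem_filter.mp ht').1)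
    (fun t ht => (Finset.mem_filter.mp ht).2)
  have h1 : T.card ≤ S.card + p := hScard ▸ card_le_card_filter_offParabola_add T
  have h1R : (T.card : ℝ) ≤ S.card + p := by exact_mod_cast h1
  have h2 : (S.card : ℝ) ≤ (p : ℝ) ^ (3 / 2 : ℝ) + p := srs_card_le_rpow S hS
  linarith

/-- **Pencils are parabola-free.**  If `K ⊆ 𝔽_p` has no non-zero square difference (a Paley
coclique, in the hypothesis format of the sibling file `…StubTangencySetsPaleyLift`), then
`𝔽_p × K` is parabola-free of size `p·|K|` (Szőnyi's pencil of parabolas, the `X = 𝔽_p` case of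
the product ansatz). [elementary] -/
theorem parabolaFree_univ_product (K : Finset (ZMod p))
    (hK : ∀ a ∈ K, ∀ b ∈ K, ∀ z : ZMod p, a - b = z ^ 2 → z = 0) :
    ((Finset.univ : Finset (ZMod p)) ×ˢ K).card = p * K.card ∧
    ∀ t ∈ (Finset.univ : Finset (ZMod p)) ×ˢ K, ∀ t' ∈ (Finset.univ : Finset (ZMod p)) ×ˢ K,
      (t'.1 - t.1) ^ 2 = t.2 - t'.2 → t'.1 = t.1 := by
  refine ⟨by rw [Finset.card_product, Finset.card_univ, ZMod.card], ?_⟩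
  intro t ht t' ht' h
  have hk : t.2 ∈ K := (Finset.mem_product.mp ht).2
  have hk' : t'.2 ∈ K := (Finset.mem_product.mp ht').2
  exact sub_eq_zero.mp (hK t.2 hk t'.2 hk' (t'.1 - t.1) h.symm)

/-- **Barrier transfer (why the NEGATION of the residual is also out of reach).**  Any bound `B`
valid for all parabola-free subsets of `𝔽_p × 𝔽_p` bounds every Paley coclique `K ⊆ 𝔽_p` by
`p·|K| ≤ B`; so proving that parabola-free sets have size `o(p^{3/2})` along the primes (the
negation of the axis' residual, predicted by HPVZ Conjecture 10.2) would give `α(Paley_p) = o(√p)`,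
i.e. break the square-root barrier for Paley graphs of prime order. [elementary] -/
theorem coclique_card_le_of_parabolaFree_bound (B : ℝ)
    (hB : ∀ T : Finset (ZMod p × ZMod p),
      (∀ t ∈ T, ∀ t' ∈ T, (t'.1 - t.1) ^ 2 = t.2 - t'.2 → t'.1 = t.1) → (T.card : ℝ) ≤ B)
    (K : Finset (ZMod p)) (hK : ∀ a ∈ K, ∀ b ∈ K, ∀ z : ZMod p, a - b = z ^ 2 → z = 0) :
    (p : ℝ) * K.card ≤ B := by
  obtain ⟨hcard, hfree⟩ := parabolaFree_univ_product K hK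
  have := hB _ hfree
  rw [hcard] at this
  exact_mod_cast this

/-- The chain end to end: a Paley coclique `K ⊆ 𝔽_p` has `|K| ≤ √p + 2` (from
`parabolaFree_card_le`; the sharper `|K|² ≤ p` is `card_coclique_sq_le` of the sibling file
`…TangencyParabolaLift`). [elementary] -/
theorem coclique_card_le_sqrt_add_two (K : Finset (ZMod p))
    (hK : ∀ a ∈ K, ∀ b ∈ K, ∀ z : ZMod p, a - b = z ^ 2 → z = 0) :
    (K.card : ℝ) ≤ Real.sqrt p + 2 := by
  have h := coclique_card_le_of_parabolaFree_bound (p := p) ((p : ℝ) ^ (3 / 2 : ℝ) + 2 * p)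
    (fun T hT => parabolaFree_card_le T hT) K hK
  have hppos : (0 : ℝ) < p := by exact_mod_cast (Fact.out : p.Prime).pos
  have h32 : (p : ℝ) ^ (3 / 2 : ℝ) = p * Real.sqrt p := by
    rw [Real.sqrt_eq_rpow, show (3 / 2 : ℝ) = 1 + 1 / 2 by norm_num, Real.rpow_add hppos,
      Real.rpow_one]
  rw [h32] at h
  have : (p : ℝ) * K.card ≤ p * (Real.sqrt p + 2) := by linarith
  exact le_of_mul_le_mul_left this hppos

end Ceiling

end Summit.MatrixMultiplication.MatrixMultiplication.Theorems.LevelOneGL2Designs.ParabolaLift
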